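import Summits.MatrixMultiplication.OmegaCensus.ThreeSetPairWZ4Z4
import Summits.MatrixMultiplication.OmegaCensus.ThreeSetPairZ4Z4TablesW3
import Summits.MatrixMultiplication.OmegaCensus.ThreeSetPairZ4Z4TablesW57
import Summits.MatrixMultiplication.OmegaCensus.ThreeSetPairZ4Z4TablesW59A
import Summits.MatrixMultiplication.OmegaCensus.ThreeSetPairZ4Z4TablesW59B
import Summits.MatrixMultiplication.OmegaCensus.ThreeSetZ4Z4Cells
import HarnessLib

/-!
# The three-set cube cells `(3,7,e)`, `(5,7,e)`, `(3,9,e)`, `(5,9,e)` over `A ↠ ℤ₄ × ℤ₄` (type-`W` pair)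

ω-census `pub-omega`, family (b3), seat pub-omega-group gen 17.  Framing: lottery ticket; floor = certified bounds/negative
ranges.  VALUE: kernel theorems about the group-theoretic method (TPP capacity of dihedral-like groups); NOT progress on ω.

Companion of `ThreeSetZ4Z4Cells.lean` for the shapes the type-`Y` pair does not certify: `three_set_pairW_reduction`
(`ThreeSetPairWZ4Z4.lean`, characters `w + w'`, `3w + w'`) + the tables `three_set_tableW_3_7`, `_3_9_p/m`, `_5_7_pp/…/mm`,
`_5_9_pp/…/mm` give `no_cube_formW_37/39/57/59_of_onto_z4z4` (three-set form level, `Y` of ANY size), the TPP statements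
`no_law_cube_37e/39e/57e/59e_of_onto_z4z4` and the all-orderings cell forms `no_law_cube_three_seven/three_nine/five_seven/
five_nine_of_onto_z4z4`.  With these the first uncovered order moves from `1072 = 3·(3·7·17) + 1` to `2080` (file
`ThreeSetZ4Z4Orders2080.lean`).
-/

namespace Summit.MatrixMultiplication.OmegaCensus

open Finset

/-! ## Core -/

section Core

variable {A : Type*} [AddCommGroup A] [Fintype A] [DecidableEq A]

/-- **No three-set form with `|W| = 3`, `|X| = 7` over `A ↠ ℤ₄²`** (type-`W` pair). [folklore] -/
theorem no_cube_formW_37_of_onto_z4z4 (Φ : A →+ ZMod 4 × ZMod 4) (hΦ : Function.Surjective Φ)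
    {W X Y : Finset A} {κ₁ κ₂ κ₃ x₀ : A} (hW : W.card = 3) (hX : X.card = 7)
    (i₁ : Set.InjOn (fun p : A × A × A => p.1 + p.2.1 + p.2.2) ↑((W.image fun w => κ₁ - w) ×ˢ X ×ˢ Y))
    (i₂ : Set.InjOn (fun p : A × A × A => p.1 + p.2.1 + p.2.2) ↑(W ×ˢ (X.image fun x => κ₂ - x) ×ˢ Y))
    (i₃ : Set.InjOn (fun p : A × A × A => p.1 + p.2.1 + p.2.2) ↑(W ×ˢ X ×ˢ (Y.image fun y => κ₃ - y)))
    (d₁₂ : Disjoint (((W.image fun w => κ₁ - w) ×ˢ X ×ˢ Y).image fun p : A × A × A => p.1 + p.2.1 + p.2.2)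
      ((W ×ˢ (X.image fun x => κ₂ - x) ×ˢ Y).image fun p : A × A × A => p.1 + p.2.1 + p.2.2))
    (d₁₃ : Disjoint (((W.image fun w => κ₁ - w) ×ˢ X ×ˢ Y).image fun p : A × A × A => p.1 + p.2.1 + p.2.2)
      ((W ×ˢ X ×ˢ (Y.image fun y => κ₃ - y)).image fun p : A × A × A => p.1 + p.2.1 + p.2.2))
    (d₂₃ : Disjoint ((W ×ˢ (X.image fun x => κ₂ - x) ×ˢ Y).image fun p : A × A × A => p.1 + p.2.1 + p.2.2)
      ((W ×ˢ X ×ˢ (Y.image fun y => κ₃ - y)).image fun p : A × A × A => p.1 + p.2.1 + p.2.2))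
    (hcover : (((W.image fun w => κ₁ - w) ×ˢ X ×ˢ Y).image fun p : A × A × A => p.1 + p.2.1 + p.2.2) ∪
      ((W ×ˢ (X.image fun x => κ₂ - x) ×ˢ Y).image fun p : A × A × A => p.1 + p.2.1 + p.2.2) ∪
      ((W ×ˢ X ×ˢ (Y.image fun y => κ₃ - y)).image fun p : A × A × A => p.1 + p.2.1 + p.2.2) = univ.erase x₀) :
    False := by
  obtain ⟨P₀, M₀, P₁, M₁, P₂, M₂, P₃, M₃, S₀, T₀, S₁, T₁, S₂, T₂, S₃, T₃, l, l₂, b, b', hsW, hsX, hAW, hB1W, hB2W,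
    hAX, hB1X, hB2X, hl₂, E1, E2⟩ := three_set_pairW_reduction Φ hΦ i₁ i₂ i₃ d₁₂ d₁₃ d₂₃ hcover
  rw [hW] at hsW
  rw [hX] at hsX
  have hm₀ : (P₀ + M₀, P₁ + M₁ + (P₂ + M₂ + (P₃ + M₃))) ∈ List.Nat.antidiagonal 3 := by
    simp only [List.Nat.mem_antidiagonal]; omega
  have hm₁ : (P₁ + M₁, P₂ + M₂ + (P₃ + M₃)) ∈ List.Nat.antidiagonal (P₀ + M₀, P₁ + M₁ + (P₂ + M₂ + (P₃ + M₃))).2 := by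
    simp only [List.Nat.mem_antidiagonal]
  have hm₂ : (P₂ + M₂, P₃ + M₃) ∈ List.Nat.antidiagonal (P₁ + M₁, P₂ + M₂ + (P₃ + M₃)).2 := by
    simp only [List.Nat.mem_antidiagonal]
  have hq₀ : (P₀, M₀) ∈ List.Nat.antidiagonal (P₀ + M₀, P₁ + M₁ + (P₂ + M₂ + (P₃ + M₃))).1 := by
    simp only [List.Nat.mem_antidiagonal]
  have hq₁ : (P₁, M₁) ∈ List.Nat.antidiagonal (P₁ + M₁, P₂ + M₂ + (P₃ + M₃)).1 := by
    simp only [List.Nat.mem_antidiagonal]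
  have hq₂ : (P₂, M₂) ∈ List.Nat.antidiagonal (P₂ + M₂, P₃ + M₃).1 := by simp only [List.Nat.mem_antidiagonal]
  have hq₃ : (P₃, M₃) ∈ List.Nat.antidiagonal (P₂ + M₂, P₃ + M₃).2 := by simp only [List.Nat.mem_antidiagonal]
  have hn₀ : (S₀ + T₀, S₁ + T₁ + (S₂ + T₂ + (S₃ + T₃))) ∈ List.Nat.antidiagonal 7 := by
    simp only [List.Nat.mem_antidiagonal]; omega
  have hn₁ : (S₁ + T₁, S₂ + T₂ + (S₃ + T₃)) ∈ List.Nat.antidiagonal (S₀ + T₀, S₁ + T₁ + (S₂ + T₂ + (S₃ + T₃))).2 := by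
    simp only [List.Nat.mem_antidiagonal]
  have hn₂ : (S₂ + T₂, S₃ + T₃) ∈ List.Nat.antidiagonal (S₁ + T₁, S₂ + T₂ + (S₃ + T₃)).2 := by
    simp only [List.Nat.mem_antidiagonal]
  have hs₀ : (S₀, T₀) ∈ List.Nat.antidiagonal (S₀ + T₀, S₁ + T₁ + (S₂ + T₂ + (S₃ + T₃))).1 := by
    simp only [List.Nat.mem_antidiagonal]
  have hs₁ : (S₁, T₁) ∈ List.Nat.antidiagonal (S₁ + T₁, S₂ + T₂ + (S₃ + T₃)).1 := by
    simp only [List.Nat.mem_antidiagonal]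
  have hs₂ : (S₂, T₂) ∈ List.Nat.antidiagonal (S₂ + T₂, S₃ + T₃).1 := by simp only [List.Nat.mem_antidiagonal]
  have hs₃ : (S₃, T₃) ∈ List.Nat.antidiagonal (S₂ + T₂, S₃ + T₃).2 := by simp only [List.Nat.mem_antidiagonal]
  rcases three_set_tableW_3_7 _ hm₀ _ hm₁ _ hm₂ hAW _ hq₀ _ hq₁ _ hq₂ _ hq₃ hB1W hB2W _ hn₀ _ hn₁ _ hn₂ hAX
      _ hs₀ _ hs₁ _ hs₂ _ hs₃ hB1X hB2X l with hk | hk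
  · exact false_of_kill3 E1 hk
  · exact false_of_kill3 E2 (hk l₂ hl₂)

/-- **No three-set form with `|W| = 3`, `|X| = 9` over `A ↠ ℤ₄²`** (type-`W` pair). [folklore] -/
theorem no_cube_formW_39_of_onto_z4z4 (Φ : A →+ ZMod 4 × ZMod 4) (hΦ : Function.Surjective Φ)
    {W X Y : Finset A} {κ₁ κ₂ κ₃ x₀ : A} (hW : W.card = 3) (hX : X.card = 9)
    (i₁ : Set.InjOn (fun p : A × A × A => p.1 + p.2.1 + p.2.2) ↑((W.image fun w => κ₁ - w) ×ˢ X ×ˢ Y))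
    (i₂ : Set.InjOn (fun p : A × A × A => p.1 + p.2.1 + p.2.2) ↑(W ×ˢ (X.image fun x => κ₂ - x) ×ˢ Y))
    (i₃ : Set.InjOn (fun p : A × A × A => p.1 + p.2.1 + p.2.2) ↑(W ×ˢ X ×ˢ (Y.image fun y => κ₃ - y)))
    (d₁₂ : Disjoint (((W.image fun w => κ₁ - w) ×ˢ X ×ˢ Y).image fun p : A × A × A => p.1 + p.2.1 + p.2.2)
      ((W ×ˢ (X.image fun x => κ₂ - x) ×ˢ Y).image fun p : A × A × A => p.1 + p.2.1 + p.2.2))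
    (d₁₃ : Disjoint (((W.image fun w => κ₁ - w) ×ˢ X ×ˢ Y).image fun p : A × A × A => p.1 + p.2.1 + p.2.2)
      ((W ×ˢ X ×ˢ (Y.image fun y => κ₃ - y)).image fun p : A × A × A => p.1 + p.2.1 + p.2.2))
    (d₂₃ : Disjoint ((W ×ˢ (X.image fun x => κ₂ - x) ×ˢ Y).image fun p : A × A × A => p.1 + p.2.1 + p.2.2)
      ((W ×ˢ X ×ˢ (Y.image fun y => κ₃ - y)).image fun p : A × A × A => p.1 + p.2.1 + p.2.2))
    (hcover : (((W.image fun w => κ₁ - w) ×ˢ X ×ˢ Y).image fun p : A × A × A => p.1 + p.2.1 + p.2.2) ∪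
      ((W ×ˢ (X.image fun x => κ₂ - x) ×ˢ Y).image fun p : A × A × A => p.1 + p.2.1 + p.2.2) ∪
      ((W ×ˢ X ×ˢ (Y.image fun y => κ₃ - y)).image fun p : A × A × A => p.1 + p.2.1 + p.2.2) = univ.erase x₀) :
    False := by
  obtain ⟨P₀, M₀, P₁, M₁, P₂, M₂, P₃, M₃, S₀, T₀, S₁, T₁, S₂, T₂, S₃, T₃, l, l₂, b, b', hsW, hsX, hAW, hB1W, hB2W,
    hAX, hB1X, hB2X, hl₂, E1, E2⟩ := three_set_pairW_reduction Φ hΦ i₁ i₂ i₃ d₁₂ d₁₃ d₂₃ hcover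
  rw [hW] at hsW
  rw [hX] at hsX
  have hm₀ : (P₀ + M₀, P₁ + M₁ + (P₂ + M₂ + (P₃ + M₃))) ∈ List.Nat.antidiagonal 3 := by
    simp only [List.Nat.mem_antidiagonal]; omega
  have hm₁ : (P₁ + M₁, P₂ + M₂ + (P₃ + M₃)) ∈ List.Nat.antidiagonal (P₀ + M₀, P₁ + M₁ + (P₂ + M₂ + (P₃ + M₃))).2 := by
    simp only [List.Nat.mem_antidiagonal]
  have hm₂ : (P₂ + M₂, P₃ + M₃) ∈ List.Nat.antidiagonal (P₁ + M₁, P₂ + M₂ + (P₃ + M₃)).2 := by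
    simp only [List.Nat.mem_antidiagonal]
  have hq₀ : (P₀, M₀) ∈ List.Nat.antidiagonal (P₀ + M₀, P₁ + M₁ + (P₂ + M₂ + (P₃ + M₃))).1 := by
    simp only [List.Nat.mem_antidiagonal]
  have hq₁ : (P₁, M₁) ∈ List.Nat.antidiagonal (P₁ + M₁, P₂ + M₂ + (P₃ + M₃)).1 := by
    simp only [List.Nat.mem_antidiagonal]
  have hq₂ : (P₂, M₂) ∈ List.Nat.antidiagonal (P₂ + M₂, P₃ + M₃).1 := by simp only [List.Nat.mem_antidiagonal]
  have hq₃ : (P₃, M₃) ∈ List.Nat.antidiagonal (P₂ + M₂, P₃ + M₃).2 := by simp only [List.Nat.mem_antidiagonal]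
  have hn₀ : (S₀ + T₀, S₁ + T₁ + (S₂ + T₂ + (S₃ + T₃))) ∈ List.Nat.antidiagonal 9 := by
    simp only [List.Nat.mem_antidiagonal]; omega
  have hn₁ : (S₁ + T₁, S₂ + T₂ + (S₃ + T₃)) ∈ List.Nat.antidiagonal (S₀ + T₀, S₁ + T₁ + (S₂ + T₂ + (S₃ + T₃))).2 := by
    simp only [List.Nat.mem_antidiagonal]
  have hn₂ : (S₂ + T₂, S₃ + T₃) ∈ List.Nat.antidiagonal (S₁ + T₁, S₂ + T₂ + (S₃ + T₃)).2 := by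
    simp only [List.Nat.mem_antidiagonal]
  have hs₀ : (S₀, T₀) ∈ List.Nat.antidiagonal (S₀ + T₀, S₁ + T₁ + (S₂ + T₂ + (S₃ + T₃))).1 := by
    simp only [List.Nat.mem_antidiagonal]
  have hs₁ : (S₁, T₁) ∈ List.Nat.antidiagonal (S₁ + T₁, S₂ + T₂ + (S₃ + T₃)).1 := by
    simp only [List.Nat.mem_antidiagonal]
  have hs₂ : (S₂, T₂) ∈ List.Nat.antidiagonal (S₂ + T₂, S₃ + T₃).1 := by simp only [List.Nat.mem_antidiagonal]
  have hs₃ : (S₃, T₃) ∈ List.Nat.antidiagonal (S₂ + T₂, S₃ + T₃).2 := by simp only [List.Nat.mem_antidiagonal]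
  rcases hAW with hW1 | hW1
  · rcases three_set_tableW_3_9_p _ hm₀ _ hm₁ _ hm₂ hW1 _ hq₀ _ hq₁ _ hq₂ _ hq₃ hB1W hB2W _ hn₀ _ hn₁ _ hn₂ hAX
        _ hs₀ _ hs₁ _ hs₂ _ hs₃ hB1X hB2X l with hk | hk
    · exact false_of_kill3 E1 hk
    · exact false_of_kill3 E2 (hk l₂ hl₂)
  · rcases three_set_tableW_3_9_m _ hm₀ _ hm₁ _ hm₂ hW1 _ hq₀ _ hq₁ _ hq₂ _ hq₃ hB1W hB2W _ hn₀ _ hn₁ _ hn₂ hAX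
        _ hs₀ _ hs₁ _ hs₂ _ hs₃ hB1X hB2X l with hk | hk
    · exact false_of_kill3 E1 hk
    · exact false_of_kill3 E2 (hk l₂ hl₂)

/-- **No three-set form with `|W| = 5`, `|X| = 7` over `A ↠ ℤ₄²`** (type-`W` pair). [folklore] -/
theorem no_cube_formW_57_of_onto_z4z4 (Φ : A →+ ZMod 4 × ZMod 4) (hΦ : Function.Surjective Φ)
    {W X Y : Finset A} {κ₁ κ₂ κ₃ x₀ : A} (hW : W.card = 5) (hX : X.card = 7)
    (i₁ : Set.InjOn (fun p : A × A × A => p.1 + p.2.1 + p.2.2) ↑((W.image fun w => κ₁ - w) ×ˢ X ×ˢ Y))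
    (i₂ : Set.InjOn (fun p : A × A × A => p.1 + p.2.1 + p.2.2) ↑(W ×ˢ (X.image fun x => κ₂ - x) ×ˢ Y))
    (i₃ : Set.InjOn (fun p : A × A × A => p.1 + p.2.1 + p.2.2) ↑(W ×ˢ X ×ˢ (Y.image fun y => κ₃ - y)))
    (d₁₂ : Disjoint (((W.image fun w => κ₁ - w) ×ˢ X ×ˢ Y).image fun p : A × A × A => p.1 + p.2.1 + p.2.2)
      ((W ×ˢ (X.image fun x => κ₂ - x) ×ˢ Y).image fun p : A × A × A => p.1 + p.2.1 + p.2.2))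
    (d₁₃ : Disjoint (((W.image fun w => κ₁ - w) ×ˢ X ×ˢ Y).image fun p : A × A × A => p.1 + p.2.1 + p.2.2)
      ((W ×ˢ X ×ˢ (Y.image fun y => κ₃ - y)).image fun p : A × A × A => p.1 + p.2.1 + p.2.2))
    (d₂₃ : Disjoint ((W ×ˢ (X.image fun x => κ₂ - x) ×ˢ Y).image fun p : A × A × A => p.1 + p.2.1 + p.2.2)
      ((W ×ˢ X ×ˢ (Y.image fun y => κ₃ - y)).image fun p : A × A × A => p.1 + p.2.1 + p.2.2))
    (hcover : (((W.image fun w => κ₁ - w) ×ˢ X ×ˢ Y).image fun p : A × A × A => p.1 + p.2.1 + p.2.2) ∪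
      ((W ×ˢ (X.image fun x => κ₂ - x) ×ˢ Y).image fun p : A × A × A => p.1 + p.2.1 + p.2.2) ∪
      ((W ×ˢ X ×ˢ (Y.image fun y => κ₃ - y)).image fun p : A × A × A => p.1 + p.2.1 + p.2.2) = univ.erase x₀) :
    False := by
  obtain ⟨P₀, M₀, P₁, M₁, P₂, M₂, P₃, M₃, S₀, T₀, S₁, T₁, S₂, T₂, S₃, T₃, l, l₂, b, b', hsW, hsX, hAW, hB1W, hB2W,
    hAX, hB1X, hB2X, hl₂, E1, E2⟩ := three_set_pairW_reduction Φ hΦ i₁ i₂ i₃ d₁₂ d₁₃ d₂₃ hcover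
  rw [hW] at hsW
  rw [hX] at hsX
  have hm₀ : (P₀ + M₀, P₁ + M₁ + (P₂ + M₂ + (P₃ + M₃))) ∈ List.Nat.antidiagonal 5 := by
    simp only [List.Nat.mem_antidiagonal]; omega
  have hm₁ : (P₁ + M₁, P₂ + M₂ + (P₃ + M₃)) ∈ List.Nat.antidiagonal (P₀ + M₀, P₁ + M₁ + (P₂ + M₂ + (P₃ + M₃))).2 := by
    simp only [List.Nat.mem_antidiagonal]
  have hm₂ : (P₂ + M₂, P₃ + M₃) ∈ List.Nat.antidiagonal (P₁ + M₁, P₂ + M₂ + (P₃ + M₃)).2 := by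
    simp only [List.Nat.mem_antidiagonal]
  have hq₀ : (P₀, M₀) ∈ List.Nat.antidiagonal (P₀ + M₀, P₁ + M₁ + (P₂ + M₂ + (P₃ + M₃))).1 := by
    simp only [List.Nat.mem_antidiagonal]
  have hq₁ : (P₁, M₁) ∈ List.Nat.antidiagonal (P₁ + M₁, P₂ + M₂ + (P₃ + M₃)).1 := by
    simp only [List.Nat.mem_antidiagonal]
  have hq₂ : (P₂, M₂) ∈ List.Nat.antidiagonal (P₂ + M₂, P₃ + M₃).1 := by simp only [List.Nat.mem_antidiagonal]
  have hq₃ : (P₃, M₃) ∈ List.Nat.antidiagonal (P₂ + M₂, P₃ + M₃).2 := by simp only [List.Nat.mem_antidiagonal]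
  have hn₀ : (S₀ + T₀, S₁ + T₁ + (S₂ + T₂ + (S₃ + T₃))) ∈ List.Nat.antidiagonal 7 := by
    simp only [List.Nat.mem_antidiagonal]; omega
  have hn₁ : (S₁ + T₁, S₂ + T₂ + (S₃ + T₃)) ∈ List.Nat.antidiagonal (S₀ + T₀, S₁ + T₁ + (S₂ + T₂ + (S₃ + T₃))).2 := by
    simp only [List.Nat.mem_antidiagonal]
  have hn₂ : (S₂ + T₂, S₃ + T₃) ∈ List.Nat.antidiagonal (S₁ + T₁, S₂ + T₂ + (S₃ + T₃)).2 := by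
    simp only [List.Nat.mem_antidiagonal]
  have hs₀ : (S₀, T₀) ∈ List.Nat.antidiagonal (S₀ + T₀, S₁ + T₁ + (S₂ + T₂ + (S₃ + T₃))).1 := by
    simp only [List.Nat.mem_antidiagonal]
  have hs₁ : (S₁, T₁) ∈ List.Nat.antidiagonal (S₁ + T₁, S₂ + T₂ + (S₃ + T₃)).1 := by
    simp only [List.Nat.mem_antidiagonal]
  have hs₂ : (S₂, T₂) ∈ List.Nat.antidiagonal (S₂ + T₂, S₃ + T₃).1 := by simp only [List.Nat.mem_antidiagonal]
  have hs₃ : (S₃, T₃) ∈ List.Nat.antidiagonal (S₂ + T₂, S₃ + T₃).2 := by simp only [List.Nat.mem_antidiagonal]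
  rcases hAW with hW1 | hW1 <;> rcases hAX with hX1 | hX1
  · rcases three_set_tableW_5_7_pp _ hm₀ _ hm₁ _ hm₂ hW1 _ hq₀ _ hq₁ _ hq₂ _ hq₃ hB1W hB2W _ hn₀ _ hn₁ _ hn₂ hX1
        _ hs₀ _ hs₁ _ hs₂ _ hs₃ hB1X hB2X l with hk | hk
    · exact false_of_kill3 E1 hk
    · exact false_of_kill3 E2 (hk l₂ hl₂)
  · rcases three_set_tableW_5_7_pm _ hm₀ _ hm₁ _ hm₂ hW1 _ hq₀ _ hq₁ _ hq₂ _ hq₃ hB1W hB2W _ hn₀ _ hn₁ _ hn₂ hX1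
        _ hs₀ _ hs₁ _ hs₂ _ hs₃ hB1X hB2X l with hk | hk
    · exact false_of_kill3 E1 hk
    · exact false_of_kill3 E2 (hk l₂ hl₂)
  · rcases three_set_tableW_5_7_mp _ hm₀ _ hm₁ _ hm₂ hW1 _ hq₀ _ hq₁ _ hq₂ _ hq₃ hB1W hB2W _ hn₀ _ hn₁ _ hn₂ hX1
        _ hs₀ _ hs₁ _ hs₂ _ hs₃ hB1X hB2X l with hk | hk
    · exact false_of_kill3 E1 hk
    · exact false_of_kill3 E2 (hk l₂ hl₂)
  · rcases three_set_tableW_5_7_mm _ hm₀ _ hm₁ _ hm₂ hW1 _ hq₀ _ hq₁ _ hq₂ _ hq₃ hB1W hB2W _ hn₀ _ hn₁ _ hn₂ hX1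
        _ hs₀ _ hs₁ _ hs₂ _ hs₃ hB1X hB2X l with hk | hk
    · exact false_of_kill3 E1 hk
    · exact false_of_kill3 E2 (hk l₂ hl₂)

/-- **No three-set form with `|W| = 5`, `|X| = 9` over `A ↠ ℤ₄²`** (type-`W` pair). [folklore] -/
theorem no_cube_formW_59_of_onto_z4z4 (Φ : A →+ ZMod 4 × ZMod 4) (hΦ : Function.Surjective Φ)
    {W X Y : Finset A} {κ₁ κ₂ κ₃ x₀ : A} (hW : W.card = 5) (hX : X.card = 9)
    (i₁ : Set.InjOn (fun p : A × A × A => p.1 + p.2.1 + p.2.2) ↑((W.image fun w => κ₁ - w) ×ˢ X ×ˢ Y))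
    (i₂ : Set.InjOn (fun p : A × A × A => p.1 + p.2.1 + p.2.2) ↑(W ×ˢ (X.image fun x => κ₂ - x) ×ˢ Y))
    (i₃ : Set.InjOn (fun p : A × A × A => p.1 + p.2.1 + p.2.2) ↑(W ×ˢ X ×ˢ (Y.image fun y => κ₃ - y)))
    (d₁₂ : Disjoint (((W.image fun w => κ₁ - w) ×ˢ X ×ˢ Y).image fun p : A × A × A => p.1 + p.2.1 + p.2.2)
      ((W ×ˢ (X.image fun x => κ₂ - x) ×ˢ Y).image fun p : A × A × A => p.1 + p.2.1 + p.2.2))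
    (d₁₃ : Disjoint (((W.image fun w => κ₁ - w) ×ˢ X ×ˢ Y).image fun p : A × A × A => p.1 + p.2.1 + p.2.2)
      ((W ×ˢ X ×ˢ (Y.image fun y => κ₃ - y)).image fun p : A × A × A => p.1 + p.2.1 + p.2.2))
    (d₂₃ : Disjoint ((W ×ˢ (X.image fun x => κ₂ - x) ×ˢ Y).image fun p : A × A × A => p.1 + p.2.1 + p.2.2)
      ((W ×ˢ X ×ˢ (Y.image fun y => κ₃ - y)).image fun p : A × A × A => p.1 + p.2.1 + p.2.2))
    (hcover : (((W.image fun w => κ₁ - w) ×ˢ X ×ˢ Y).image fun p : A × A × A => p.1 + p.2.1 + p.2.2) ∪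
      ((W ×ˢ (X.image fun x => κ₂ - x) ×ˢ Y).image fun p : A × A × A => p.1 + p.2.1 + p.2.2) ∪
      ((W ×ˢ X ×ˢ (Y.image fun y => κ₃ - y)).image fun p : A × A × A => p.1 + p.2.1 + p.2.2) = univ.erase x₀) :
    False := by
  obtain ⟨P₀, M₀, P₁, M₁, P₂, M₂, P₃, M₃, S₀, T₀, S₁, T₁, S₂, T₂, S₃, T₃, l, l₂, b, b', hsW, hsX, hAW, hB1W, hB2W,
    hAX, hB1X, hB2X, hl₂, E1, E2⟩ := three_set_pairW_reduction Φ hΦ i₁ i₂ i₃ d₁₂ d₁₃ d₂₃ hcover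
  rw [hW] at hsW
  rw [hX] at hsX
  have hm₀ : (P₀ + M₀, P₁ + M₁ + (P₂ + M₂ + (P₃ + M₃))) ∈ List.Nat.antidiagonal 5 := by
    simp only [List.Nat.mem_antidiagonal]; omega
  have hm₁ : (P₁ + M₁, P₂ + M₂ + (P₃ + M₃)) ∈ List.Nat.antidiagonal (P₀ + M₀, P₁ + M₁ + (P₂ + M₂ + (P₃ + M₃))).2 := by
    simp only [List.Nat.mem_antidiagonal]
  have hm₂ : (P₂ + M₂, P₃ + M₃) ∈ List.Nat.antidiagonal (P₁ + M₁, P₂ + M₂ + (P₃ + M₃)).2 := by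
    simp only [List.Nat.mem_antidiagonal]
  have hq₀ : (P₀, M₀) ∈ List.Nat.antidiagonal (P₀ + M₀, P₁ + M₁ + (P₂ + M₂ + (P₃ + M₃))).1 := by
    simp only [List.Nat.mem_antidiagonal]
  have hq₁ : (P₁, M₁) ∈ List.Nat.antidiagonal (P₁ + M₁, P₂ + M₂ + (P₃ + M₃)).1 := by
    simp only [List.Nat.mem_antidiagonal]
  have hq₂ : (P₂, M₂) ∈ List.Nat.antidiagonal (P₂ + M₂, P₃ + M₃).1 := by simp only [List.Nat.mem_antidiagonal]
  have hq₃ : (P₃, M₃) ∈ List.Nat.antidiagonal (P₂ + M₂, P₃ + M₃).2 := by simp only [List.Nat.mem_antidiagonal]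
  have hn₀ : (S₀ + T₀, S₁ + T₁ + (S₂ + T₂ + (S₃ + T₃))) ∈ List.Nat.antidiagonal 9 := by
    simp only [List.Nat.mem_antidiagonal]; omega
  have hn₁ : (S₁ + T₁, S₂ + T₂ + (S₃ + T₃)) ∈ List.Nat.antidiagonal (S₀ + T₀, S₁ + T₁ + (S₂ + T₂ + (S₃ + T₃))).2 := by
    simp only [List.Nat.mem_antidiagonal]
  have hn₂ : (S₂ + T₂, S₃ + T₃) ∈ List.Nat.antidiagonal (S₁ + T₁, S₂ + T₂ + (S₃ + T₃)).2 := by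
    simp only [List.Nat.mem_antidiagonal]
  have hs₀ : (S₀, T₀) ∈ List.Nat.antidiagonal (S₀ + T₀, S₁ + T₁ + (S₂ + T₂ + (S₃ + T₃))).1 := by
    simp only [List.Nat.mem_antidiagonal]
  have hs₁ : (S₁, T₁) ∈ List.Nat.antidiagonal (S₁ + T₁, S₂ + T₂ + (S₃ + T₃)).1 := by
    simp only [List.Nat.mem_antidiagonal]
  have hs₂ : (S₂, T₂) ∈ List.Nat.antidiagonal (S₂ + T₂, S₃ + T₃).1 := by simp only [List.Nat.mem_antidiagonal]
  have hs₃ : (S₃, T₃) ∈ List.Nat.antidiagonal (S₂ + T₂, S₃ + T₃).2 := by simp only [List.Nat.mem_antidiagonal]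
  rcases hAW with hW1 | hW1 <;> rcases hAX with hX1 | hX1
  · rcases three_set_tableW_5_9_pp _ hm₀ _ hm₁ _ hm₂ hW1 _ hq₀ _ hq₁ _ hq₂ _ hq₃ hB1W hB2W _ hn₀ _ hn₁ _ hn₂ hX1
        _ hs₀ _ hs₁ _ hs₂ _ hs₃ hB1X hB2X l with hk | hk
    · exact false_of_kill3 E1 hk
    · exact false_of_kill3 E2 (hk l₂ hl₂)
  · rcases three_set_tableW_5_9_pm _ hm₀ _ hm₁ _ hm₂ hW1 _ hq₀ _ hq₁ _ hq₂ _ hq₃ hB1W hB2W _ hn₀ _ hn₁ _ hn₂ hX1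
        _ hs₀ _ hs₁ _ hs₂ _ hs₃ hB1X hB2X l with hk | hk
    · exact false_of_kill3 E1 hk
    · exact false_of_kill3 E2 (hk l₂ hl₂)
  · rcases three_set_tableW_5_9_mp _ hm₀ _ hm₁ _ hm₂ hW1 _ hq₀ _ hq₁ _ hq₂ _ hq₃ hB1W hB2W _ hn₀ _ hn₁ _ hn₂ hX1
        _ hs₀ _ hs₁ _ hs₂ _ hs₃ hB1X hB2X l with hk | hk
    · exact false_of_kill3 E1 hk
    · exact false_of_kill3 E2 (hk l₂ hl₂)
  · rcases three_set_tableW_5_9_mm _ hm₀ _ hm₁ _ hm₂ hW1 _ hq₀ _ hq₁ _ hq₂ _ hq₃ hB1W hB2W _ hn₀ _ hn₁ _ hn₂ hX1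
        _ hs₀ _ hs₁ _ hs₂ _ hs₃ hB1X hB2X l with hk | hk
    · exact false_of_kill3 E1 hk
    · exact false_of_kill3 E2 (hk l₂ hl₂)

end Core

end Summit.MatrixMultiplication.OmegaCensus
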